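import Summits.Ventures.CertifiedArithmetic.LowPrec.DoubleRoundingThresholdWitness

/-!
# Double rounding at a general midpoint — the product strip `P_X < P_Y < 2 P_X` (THEOREM D-dm)

HONEST FRAMING: certified error envelopes and provably optimal rounding/accumulation schemes for
low-precision formats under stated cost models; every table by two implementations; no hardware
or vendor claims.

`DoubleRoundingThresholdWitness.lean` evaluates the two roundings at the midpoint just above a
power of two.  This file does the same at a GENERAL midpoint of the normal range of `φ`: for an
even significand `2^(P-1) ≤ t < 2^P`, a scale `k`, and a rational offset `0 < δ`,
`x = (2t+1)·2^k · quantum φ + δ` sits above the midpoint `μ = (2t+1)·2^k` of the consecutive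
values `t·2^(k+1) < (t+1)·2^(k+1)` of `φ`.  Then, for EVERY pair of format records `φ ⊆ ψ`
(`quantum ψ ∣ quantum φ`, range of `φ` inside `ψ`, `P_φ < P_ψ`):

* `toRat_roundNE_gmid`       — `fl_φ μ = t·2^(k+1)` (tie to the even side; `P_φ ≥ 2`);
* `toRat_roundNE_above_gmid` — `fl_φ x = (t+1)·2^(k+1)` when `δ < 2^k · quantum φ`;
* `toRat_roundNE_wide_gmid`  — `fl_ψ x = μ` when `2δ` is below the spacing of `ψ` at `μ`,
  `2δ < 2^(P_φ + k + d - P_ψ) · quantum ψ · 2` with `2^d = quantum φ / quantum ψ`;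
* `roundNE_roundNE_ne_gmid`  — hence `fl_φ (fl_ψ x) ≠ fl_φ x`: ANY operation producing such
  an `x` from `φ`-data is double rounded wrongly through `ψ`; `not_drMul_of_gmid_witness` is
  the product form (two `φ`-data with `a·b = x`; `δ` need not be a whole quantum — products
  are not).

THE STRIP FOR PRODUCTS.  With unbounded exponents, `P_φ < P_ψ < 2 P_φ` is innocuous for
products iff `P_φ ≤ 3` (implementation A, `DOUBLE-ROUNDING-MUL.md` §4b, brute force `P ≤ 8`);
for `P_φ ≥ 5` the square of `s_P = 3·2^(P-2) - 1` is `(2t+1)·2^(P-1) + 1` with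
`t = 9·2^(P-4) - 2` even (`P = 4`: `13² = 21·8 + 1`, `t = 10`), an instance of the present
lemmas for every `P_ψ ≤ 2P - 2` whenever the two factors `s_P · 2^j` are data of `φ`.  Named
instances (`gmid_cell_…`): e2m3 → binary8p5 at `13/8 · 13/8 = 169/64 ↦ 21/8 ↦ 5/2`, direct
`11/4` (`t = 10`, `k = 0`, `δ = quantum/8`: NOT a whole number of quanta of e2m3, whose range
— `60` quanta — holds no integral instance), and binary8p5 → bfloat16 at `23/16 · 23/8`
(`t = 16`, `k = 4`, `δ = quantum`).  The e3m2 failures into the `P = 4` formats are subnormal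
effects (midpoints at half-quanta) and stay witnesses (`DoubleRoundingProductCells.lean`).

Implementation A: `code/enum/doublemul_decision.py`.  References: [Figueroa1995] §3 (products,
`p₂ ≥ 2p₁`); [Roux2014] Table II; [MartinDorelMelquiondMuller2013] Property 2.1 (a double
rounding slip forces the intermediate result onto a midpoint of the target format — the
present lemmas are the converse construction at a prescribed midpoint), its §1 (the
sufficient conditions are stated for target precision `p ≥ 4`; implementation A finds the
strip innocuous below that) and Example 1.1 (binary64 products through the x87 extended
format: `a·b = 2^65 + 2^12 + 1`, the power-of-two midpoint of `DoubleRoundingProductMidpoint`);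
[Rump2016] Lemma 4.4 (the power-of-two midpoint for sums).
-/

namespace Summit.Ventures.CertifiedArithmetic

open Literature.ComputerArithmetic.FloatingPoint
open Literature.ComputerArithmetic.FloatingPoint.Format
open Literature.ComputerArithmetic.FloatingPoint.MiniFloat

/-! ## §1 The two neighbours of a general midpoint -/

/-- The neighbours `t·2^(k+1)` and `(t+1)·2^(k+1)` quanta are values of `φ` (`t < 2^P`,
`(t+1)·2^(k+1) ≤ maxScaled`). -/
theorem representable_gmid {φ : Format} {t k : ℕ} (hthi : t < 2 ^ (φ.manBits + 1))
    (hu : (t + 1) * 2 ^ (k + 1) ≤ φ.maxScaled) :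
    φ.Representable (t * 2 ^ (k + 1)) ∧ φ.Representable ((t + 1) * 2 ^ (k + 1)) := by
  have h0 : t * 2 ^ (k + 1) ≤ (t + 1) * 2 ^ (k + 1) := Nat.mul_le_mul_right _ (Nat.le_succ t)
  have hp : 2 ^ (φ.manBits + 1) * 2 ^ (k + 1) = 2 ^ (φ.manBits + 1 + (k + 1)) := by
    rw [← pow_add]
  constructor
  · refine representable_of_pow_dvd (g := k + 1) ⟨t, by ring⟩ ?_ (le_trans h0 hu)
    rw [← hp]; exact Nat.mul_le_mul_right _ hthi.le
  · refine representable_of_pow_dvd (g := k + 1) ⟨t + 1, by ring⟩ ?_ hu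
    rw [← hp]; exact Nat.mul_le_mul_right _ hthi

/-- GAP: no value of `φ` lies strictly between `t·2^(k+1)` and `(t+1)·2^(k+1)` quanta when
`2^(P-1) ≤ t` (a normal binade, spacing `2^(k+1)` quanta). -/
theorem gap_gmid {φ : Format} {t k : ℕ} (htlo : 2 ^ φ.manBits ≤ t) {v0 : MiniFloat φ}
    (hv0 : v0.toRat = ((t * 2 ^ (k + 1) : ℕ) : ℚ) * φ.quantum) (y : MiniFloat φ) :
    y.toRat ≤ ((t * 2 ^ (k + 1) : ℕ) : ℚ) * φ.quantum ∨
      (((t + 1) * 2 ^ (k + 1) : ℕ) : ℚ) * φ.quantum ≤ y.toRat := by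
  rcases le_or_gt y.toRat (((t * 2 ^ (k + 1) : ℕ) : ℚ) * φ.quantum) with h | h
  · exact Or.inl h
  right
  have hq := φ.quantum_pos
  have hz0 : 0 ≤ v0.toRat := by rw [hv0]; positivity
  have hS : v0.scaledMag = t * 2 ^ (k + 1) := scaledMag_eq_of_toRat_eq hv0
  have he : k + 1 ≤ v0.expCode - 1 := by
    apply succ_le_ulpExp_of_le_scaledMag (k := k)
    rw [hS, show φ.manBits + 1 + k = φ.manBits + (k + 1) by ring, pow_add]
    exact Nat.mul_le_mul_right _ htlo
  have h1 := add_ulp_le_of_lt (y := y) hz0 (by rw [hv0]; exact h)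
  have h2 : (2 : ℚ) ^ (k + 1) ≤ 2 ^ (v0.expCode - 1) := pow_le_pow_right₀ (by norm_num) he
  calc (((t + 1) * 2 ^ (k + 1) : ℕ) : ℚ) * φ.quantum
      = v0.toRat + 2 ^ (k + 1) * φ.quantum := by rw [hv0]; push_cast; ring
    _ ≤ v0.toRat + 2 ^ (v0.expCode - 1) * φ.quantum := by nlinarith
    _ ≤ y.toRat := h1

/-! ## §2 The three roundings -/

/-- THE MIDPOINT GOES TO THE EVEN SIDE: `fl_φ ((2t+1)·2^k) = t·2^(k+1)` quanta for `t` even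
(`P ≥ 2`; a tie, the upper neighbour `(t+1)·2^(k+1)` has an odd significand). -/
theorem toRat_roundNE_gmid {φ : Format} (h1 : 1 ≤ φ.manBits) {t k : ℕ} (ht : Even t)
    (htlo : 2 ^ φ.manBits ≤ t) (hthi : t < 2 ^ (φ.manBits + 1))
    (hu : (t + 1) * 2 ^ (k + 1) ≤ φ.maxScaled) :
    (roundNE φ ((((2 * t + 1) * 2 ^ k : ℕ) : ℚ) * φ.quantum)).toRat
      = ((t * 2 ^ (k + 1) : ℕ) : ℚ) * φ.quantum := by
  have hq := φ.quantum_pos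
  obtain ⟨hr0, hru⟩ := representable_gmid hthi hu
  obtain ⟨v0, hv0⟩ := exists_toRat_eq_natMul hr0
  obtain ⟨yu, hyu⟩ := exists_toRat_eq_natMul hru
  set x := (((2 * t + 1) * 2 ^ k : ℕ) : ℚ) * φ.quantum with hx
  set T := (2 : ℚ) ^ k * φ.quantum with hT
  have hT0 : 0 < T := by positivity
  have exv : x - v0.toRat = T := by rw [hx, hv0]; push_cast; ring
  have exu : x - yu.toRat = -T := by rw [hx, hyu]; push_cast; ring
  have hnear := roundNE_nearest (φ := φ) x v0
  rw [exv, abs_of_pos hT0] at hnear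
  have hor : (roundNE φ x).toRat = v0.toRat ∨ (roundNE φ x).toRat = yu.toRat := by
    rcases gap_gmid htlo hv0 (roundNE φ x) with h | h
    · rw [← hv0] at h
      left
      rw [abs_of_nonneg (by linarith)] at hnear
      linarith
    · rw [← hyu] at h
      right
      rw [abs_of_nonpos (by linarith)] at hnear
      linarith
  rcases hor with h | h
  · rw [h, hv0]
  · exfalso
    have hev : 2 ∣ (roundNE φ x).man :=
      roundNE_man_even_of_tie h1 (y := v0) (by rw [h, exv, exu, abs_neg])
        (by rw [h]; intro heq; linarith)
    rw [two_dvd_man_iff h1] at hev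
    have hS : (roundNE φ x).scaledMag = (t + 1) * 2 ^ (k + 1) :=
      scaledMag_eq_of_toRat_eq (by rw [h, hyu])
    have he : k + 1 ≤ (roundNE φ x).expCode - 1 := by
      apply succ_le_ulpExp_of_le_scaledMag (k := k)
      rw [hS, show φ.manBits + 1 + k = φ.manBits + (k + 1) by ring, pow_add]
      exact Nat.mul_le_mul_right _ (by omega)
    rw [hS] at hev
    obtain ⟨r, hr⟩ := Nat.exists_eq_add_of_le he
    have h2 : 2 * 2 ^ ((roundNE φ x).expCode - 1) = (2 ^ (k + 1) * 2) * 2 ^ r := by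
      rw [hr]; ring
    have h3 : 2 ^ (k + 1) * 2 ∣ (t + 1) * 2 ^ (k + 1) := dvd_trans (Dvd.intro _ h2.symm) hev
    rw [mul_comm (t + 1)] at h3
    have h4 : 2 ∣ t + 1 := Nat.dvd_of_mul_dvd_mul_left (by positivity) h3
    obtain ⟨c, hc⟩ := ht
    omega

/-- ABOVE THE MIDPOINT GOES UP: `fl_φ ((2t+1)·2^k · quantum + δ) = (t+1)·2^(k+1)` quanta for
`0 < δ < 2^k · quantum` (the unique nearest value; `δ` is any rational). -/
theorem toRat_roundNE_above_gmid {φ : Format} {t k : ℕ} (htlo : 2 ^ φ.manBits ≤ t)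
    (hthi : t < 2 ^ (φ.manBits + 1)) (hu : (t + 1) * 2 ^ (k + 1) ≤ φ.maxScaled) {δ : ℚ}
    (hδ0 : 0 < δ) (hδ : δ < 2 ^ k * φ.quantum) :
    (roundNE φ ((((2 * t + 1) * 2 ^ k : ℕ) : ℚ) * φ.quantum + δ)).toRat
      = (((t + 1) * 2 ^ (k + 1) : ℕ) : ℚ) * φ.quantum := by
  have hq := φ.quantum_pos
  obtain ⟨hr0, hru⟩ := representable_gmid hthi hu
  obtain ⟨v0, hv0⟩ := exists_toRat_eq_natMul hr0
  obtain ⟨yu, hyu⟩ := exists_toRat_eq_natMul hru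
  rw [← hyu]
  apply toRat_roundNE_eq_of_forall_lt ⟨yu, rfl⟩
  intro y hy
  set x := (((2 * t + 1) * 2 ^ k : ℕ) : ℚ) * φ.quantum + δ with hx
  set T := (2 : ℚ) ^ k * φ.quantum with hT
  have exv : x - v0.toRat = T + δ := by rw [hx, hv0]; push_cast; ring
  have exu : x - yu.toRat = δ - T := by rw [hx, hyu]; push_cast; ring
  rw [exu, abs_of_nonpos (by linarith)]
  rcases gap_gmid htlo hv0 y with h | h
  · rw [← hv0] at h
    rw [abs_of_nonneg (by linarith)]
    linarith
  · rw [← hyu] at h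
    have h' : yu.toRat < y.toRat := lt_of_le_of_ne h (Ne.symm hy)
    rw [abs_of_nonpos (by linarith)]
    linarith

/-- THE INTERMEDIATE ROUNDING LANDS ON THE MIDPOINT: for `quantum ψ ∣ quantum φ` (`hq`), the
range of `φ` inside `ψ` (`hM`) and `P_φ < P_ψ`, the midpoint `μ = (2t+1)·2^k · quantum φ` is
a value of `ψ`, the spacing of `ψ` above it is at least `2^(P_φ+k+d-P_ψ) · 2 · quantum ψ`
(`2^d = quantum φ / quantum ψ`), and `fl_ψ (μ + δ) = μ` as soon as `2δ` is below that. -/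
theorem toRat_roundNE_wide_gmid {φ ψ : Format} (hq : ψ.qexp ≤ φ.qexp)
    (hM : φ.maxScaled * 2 ^ (φ.qexp - ψ.qexp).toNat ≤ ψ.maxScaled)
    (hP : φ.manBits < ψ.manBits) {t k : ℕ} (htlo : 2 ^ φ.manBits ≤ t)
    (hthi : t < 2 ^ (φ.manBits + 1)) (hu : (t + 1) * 2 ^ (k + 1) ≤ φ.maxScaled)
    (hk' : ψ.manBits ≤ φ.manBits + k + (φ.qexp - ψ.qexp).toNat) {δ : ℚ} (hδ0 : 0 < δ)
    (hδψ : 2 * δ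
      < 2 ^ (φ.manBits + k + (φ.qexp - ψ.qexp).toNat + 1 - ψ.manBits) * ψ.quantum) :
    (roundNE ψ ((((2 * t + 1) * 2 ^ k : ℕ) : ℚ) * φ.quantum + δ)).toRat
      = (((2 * t + 1) * 2 ^ k : ℕ) : ℚ) * φ.quantum := by
  have hqφ := φ.quantum_pos
  have hqψ := ψ.quantum_pos
  set d := (φ.qexp - ψ.qexp).toNat with hd
  set n : ℕ := (2 * t + 1) * 2 ^ k with hn
  -- `μ = n · quantum φ` is a value of `ψ`
  have hnle : n ≤ 2 ^ (ψ.manBits + 1 + k) := by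
    have h2 : 2 * t + 1 ≤ 2 ^ (φ.manBits + 2) := by
      rw [show φ.manBits + 2 = (φ.manBits + 1) + 1 by ring, pow_succ]; omega
    have h3 : 2 ^ (φ.manBits + 2) ≤ 2 ^ (ψ.manBits + 1) :=
      Nat.pow_le_pow_right (by norm_num) (by omega)
    calc n = (2 * t + 1) * 2 ^ k := hn
      _ ≤ 2 ^ (ψ.manBits + 1) * 2 ^ k := Nat.mul_le_mul_right _ (le_trans h2 h3)
      _ = 2 ^ (ψ.manBits + 1 + k) := by rw [← pow_add]
  have hnmax : n ≤ φ.maxScaled := by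
    refine le_trans ?_ hu
    rw [hn, pow_succ]; nlinarith
  obtain ⟨zμ, hzμ⟩ := exists_toRat_eq_natMul_of_dvd hq hM (g := k) (n := n)
    ⟨2 * t + 1, by rw [hn]; ring⟩ hnle hnmax
  -- its spacing in `ψ`
  have hquant : φ.quantum = 2 ^ d * ψ.quantum := quantum_eq_two_pow_mul hq
  have hzμ' : zμ.toRat = ((n * 2 ^ d : ℕ) : ℚ) * ψ.quantum := by
    rw [hzμ, hquant]; push_cast; ring
  have hz0 : 0 ≤ zμ.toRat := by rw [hzμ]; positivity
  have hS : zμ.scaledMag = n * 2 ^ d := scaledMag_eq_of_toRat_eq hzμ'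
  obtain ⟨r, hr⟩ := Nat.exists_eq_add_of_le hk'
  -- `r = P_φ + k + d - P_ψ`; `2^(P_ψ + 1 + r) ≤ n 2^d`
  have he : r + 1 ≤ zμ.expCode - 1 := by
    apply succ_le_ulpExp_of_le_scaledMag (k := r)
    rw [hS, hn]
    have h5 : 2 ^ (ψ.manBits + 1 + r) = 2 ^ (φ.manBits + 1) * 2 ^ k * 2 ^ d := by
      rw [← pow_add, ← pow_add]; congr 1; omega
    rw [h5, pow_succ]
    exact Nat.mul_le_mul_right _ (Nat.mul_le_mul_right _ (by omega))
  have hexp : φ.manBits + k + d + 1 - ψ.manBits = r + 1 := by omega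
  rw [hexp] at hδψ
  have hulp : (2 : ℚ) ^ (r + 1) ≤ 2 ^ (zμ.expCode - 1) := pow_le_pow_right₀ (by norm_num) he
  -- uniqueness of the nearest value
  have key : (roundNE ψ ((n : ℚ) * φ.quantum + δ)).toRat = zμ.toRat := by
    apply toRat_roundNE_eq_of_forall_lt ⟨zμ, rfl⟩
    intro y hy
    rw [hzμ, show (n : ℚ) * φ.quantum + δ - (n : ℚ) * φ.quantum = δ by ring,
      abs_of_pos hδ0]
    rcases lt_or_gt_of_ne hy with h | h
    · -- `y` below `μ`
      rw [hzμ] at h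
      rw [abs_of_pos (by linarith)]
      linarith
    · -- `y` above `μ`: at least one spacing of `ψ` away
      have h1 := add_ulp_le_of_lt (y := y) hz0 h
      rw [hzμ] at h1 h
      have h6 : (2 : ℚ) ^ (r + 1) * ψ.quantum ≤ 2 ^ (zμ.expCode - 1) * ψ.quantum :=
        mul_le_mul_of_nonneg_right hulp hqψ.le
      rw [abs_of_nonpos (by linarith)]
      linarith
  rw [key, hzμ]

/-! ## §3 The failing double rounding and its product form -/

/-- DOUBLE ROUNDING FAILS ABOVE A GENERAL MIDPOINT — for every pair of format records: under
the hypotheses of `toRat_roundNE_wide_gmid` with `t` even and `P_φ ≥ 2`,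
`fl_φ (fl_ψ x) = t·2^(k+1) ≠ (t+1)·2^(k+1) = fl_φ x` (quanta) at
`x = (2t+1)·2^k · quantum φ + δ`. -/
theorem roundNE_roundNE_ne_gmid {φ ψ : Format} (hq : ψ.qexp ≤ φ.qexp)
    (hM : φ.maxScaled * 2 ^ (φ.qexp - ψ.qexp).toNat ≤ ψ.maxScaled) (h1 : 1 ≤ φ.manBits)
    (hP : φ.manBits < ψ.manBits) {t k : ℕ} (ht : Even t) (htlo : 2 ^ φ.manBits ≤ t)
    (hthi : t < 2 ^ (φ.manBits + 1)) (hu : (t + 1) * 2 ^ (k + 1) ≤ φ.maxScaled)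
    (hk' : ψ.manBits ≤ φ.manBits + k + (φ.qexp - ψ.qexp).toNat) {δ : ℚ} (hδ0 : 0 < δ)
    (hδψ : 2 * δ
      < 2 ^ (φ.manBits + k + (φ.qexp - ψ.qexp).toNat + 1 - ψ.manBits) * ψ.quantum) :
    (roundNE φ (roundNE ψ ((((2 * t + 1) * 2 ^ k : ℕ) : ℚ) * φ.quantum + δ)).toRat).toRat
      ≠ (roundNE φ ((((2 * t + 1) * 2 ^ k : ℕ) : ℚ) * φ.quantum + δ)).toRat := by
  have hqφ := φ.quantum_pos
  have hqψ := ψ.quantum_pos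
  -- `δ < 2^k · quantum φ` follows from `hδψ`: the spacing of `ψ` at `μ` is at most `φ`'s
  have hδ : δ < 2 ^ k * φ.quantum := by
    have hquant : φ.quantum = 2 ^ (φ.qexp - ψ.qexp).toNat * ψ.quantum :=
      quantum_eq_two_pow_mul hq
    have h2 : (2 : ℚ) ^ (φ.manBits + k + (φ.qexp - ψ.qexp).toNat + 1 - ψ.manBits)
        ≤ 2 ^ (k + (φ.qexp - ψ.qexp).toNat) := pow_le_pow_right₀ (by norm_num) (by omega)
    have h3 : (2 : ℚ) ^ (k + (φ.qexp - ψ.qexp).toNat) * ψ.quantum = 2 ^ k * φ.quantum := by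
      rw [hquant, pow_add]; ring
    have h4 := mul_le_mul_of_nonneg_right h2 hqψ.le
    rw [h3] at h4
    linarith
  rw [toRat_roundNE_wide_gmid hq hM hP htlo hthi hu hk' hδ0 hδψ,
    toRat_roundNE_gmid h1 ht htlo hthi hu, toRat_roundNE_above_gmid htlo hthi hu hδ0 hδ]
  intro h
  have h' := mul_right_cancel₀ hqφ.ne' h
  have h'' : t * 2 ^ (k + 1) = (t + 1) * 2 ^ (k + 1) := by exact_mod_cast h'
  have h3 := Nat.eq_of_mul_eq_mul_right (by positivity) h''
  omega

/-- THE PRODUCT FORM — for every pair of format records: two `φ`-data whose product is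
`(2t+1)·2^k · quantum φ + δ` as above refute `∀ a b, fl_φ (fl_ψ (a·b)) = fl_φ (a·b)`. For
`P_φ ≥ 5` and every `P_φ < P_ψ ≤ 2P_φ - 2` such data are `a = b = (3·2^(P-2) - 1) · 2^j`
whenever in range (`t = 9·2^(P-4) - 2`); `P_φ = 4`: `13 · 2^j` (`t = 10`). -/
theorem not_drMul_of_gmid_witness {φ ψ : Format} (hq : ψ.qexp ≤ φ.qexp)
    (hM : φ.maxScaled * 2 ^ (φ.qexp - ψ.qexp).toNat ≤ ψ.maxScaled) (h1 : 1 ≤ φ.manBits)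
    (hP : φ.manBits < ψ.manBits) {t k : ℕ} (ht : Even t) (htlo : 2 ^ φ.manBits ≤ t)
    (hthi : t < 2 ^ (φ.manBits + 1)) (hu : (t + 1) * 2 ^ (k + 1) ≤ φ.maxScaled)
    (hk' : ψ.manBits ≤ φ.manBits + k + (φ.qexp - ψ.qexp).toNat) {δ : ℚ} (hδ0 : 0 < δ)
    (hδψ : 2 * δ
      < 2 ^ (φ.manBits + k + (φ.qexp - ψ.qexp).toNat + 1 - ψ.manBits) * ψ.quantum)
    (a b : MiniFloat φ)
    (hab : a.toRat * b.toRat = (((2 * t + 1) * 2 ^ k : ℕ) : ℚ) * φ.quantum + δ) :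
    ¬ ∀ a b : MiniFloat φ, (roundNE φ (roundNE ψ (a.toRat * b.toRat)).toRat).toRat
      = (roundNE φ (a.toRat * b.toRat)).toRat := by
  intro h
  have hab' := h a b
  rw [hab] at hab'
  exact roundNE_roundNE_ne_gmid hq hM h1 hP ht htlo hthi hu hk' hδ0 hδψ hab'

/-- THE STRIP CELL e2m3 → binary8p5 AS AN INSTANCE (`t = 10`, `k = 0`, `δ = 1/64 =
quantum/8`): EVERY pair of e2m3 data with product `169/64 = 21 · (1/8) + 1/64` — e.g.
`13/8 · 13/8` — is double rounded wrongly through binary8p5 (`169/64 ↦ 21/8 ↦ 5/2`, direct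
`11/4`).  The cell statement itself is `precisionDeficient_mul_fails`
(`DoubleRoundingProductCells.lean`, first witness `5/8 · 15/8`). -/
theorem gmid_cell_E2M3_Binary8p5 (a b : MiniFloat E2M3) (hab : a.toRat * b.toRat = 169 / 64) :
    (roundNE E2M3 (roundNE Binary8p5 (a.toRat * b.toRat)).toRat).toRat
      ≠ (roundNE E2M3 (a.toRat * b.toRat)).toRat := by
  have e : (169 : ℚ) / 64 = (((2 * 10 + 1) * 2 ^ 0 : ℕ) : ℚ) * E2M3.quantum + 1 / 64 := by
    decide +kernel
  rw [hab, e]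
  exact roundNE_roundNE_ne_gmid (φ := E2M3) (ψ := Binary8p5) (by decide) (by decide +kernel)
    (by decide) (by decide) ⟨5, rfl⟩ (by decide) (by decide) (by decide +kernel)
    (by decide +kernel) (by norm_num) (by decide +kernel)

/-- THE STRIP CELL binary8p5 → bfloat16 AS AN INSTANCE (`t = 16`, `k = 4`, `δ = 2^-7 =
quantum`): EVERY pair of binary8p5 data with product `529/128 = 33 · 16 · 2^-7 + 2^-7` — e.g.
`23/16 · 23/8` — is double rounded wrongly through bfloat16 (`529/128 ↦ 33/8 ↦ 4`, direct
`17/4`; also the power-of-two special case `not_drMul_Binary8p5_BFloat16_sq`).  The cell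
statement itself is `precisionDeficient_mul_fails` (first witness `9/128 · 31/16`). -/
theorem gmid_cell_Binary8p5_BFloat16 (a b : MiniFloat Binary8p5)
    (hab : a.toRat * b.toRat = 529 / 128) :
    (roundNE Binary8p5 (roundNE BFloat16 (a.toRat * b.toRat)).toRat).toRat
      ≠ (roundNE Binary8p5 (a.toRat * b.toRat)).toRat := by
  have e : (529 : ℚ) / 128
      = (((2 * 16 + 1) * 2 ^ 4 : ℕ) : ℚ) * Binary8p5.quantum + 1 / 2 ^ 7 := by
    decide +kernel
  rw [hab, e]
  exact roundNE_roundNE_ne_gmid (φ := Binary8p5) (ψ := BFloat16) (by decide) (by decide +kernel)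
    (by decide) (by decide) ⟨8, rfl⟩ (by decide) (by decide) (by decide +kernel)
    (by decide +kernel) (by norm_num) (by decide +kernel)

end Summit.Ventures.CertifiedArithmetic
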